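import Mathlib
import Summits.Ventures.PercRepro2.CrossSection
import Summits.Ventures.PercRepro2.GoodCoordinate
import Summits.Ventures.PercRepro2.AS3Cases

/-!
# The slack-carrying induction for (AS3): the self-consistent hypothesis (GC-f)
(seat mine-b, cell pub-perc-repro2; conjectures/MINE-B.md §15 Addendum 8, proofs/MINE-B-CROSSSECTION.md §5)

The single-coordinate induction of GoodCoordinate.lean fails on 6 elements (NEG-B17: a nested pair whose
every coordinate has `D_i + E_i − N_i = −1` while `Φ = 3`): the cross pairs' own slack must be carried.
Here the induction hypothesis is strengthened to `Φ ≥ f` for the explicit slack function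

  `f(U; A, B) = Φ(U; A, B)` if `A` is principal (`A = {γ : K ⊆ γ}`, where `Φ ≥ 0` is a theorem,
  `AS3_of_principal`), and `f(U; A, B) = max_{i ∈ U} (D_i + E_i − N_i)⁺` otherwise

(`fval`; `surplus U' A B i = D_i + E_i − N_i` on `insert i U'`).

* `Phi_ge_fval_of_GCf` — if every pair `(A, B)` with `A` not principal on every nonempty cube has a
  coordinate `i` with `f(A,B) ≤ surplus_i + f(A, B₁) + f(A₁, B)` (the hypothesis (GC-f)), then
  `f ≤ Φ` for every pair on every cube (strong induction on the cube through `Phi_insert`);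
* `AS3_of_GCf` — hence (AS3) for every pair on every finite cube.

(GC-f) subsumes the good-coordinate criterion (a good coordinate `i*` gives `f(A,B) = surplus_{i*} ≤
surplus_{i*} + f + f`) and asks, where no good coordinate exists, that the deficit be covered by the best
single-coordinate surpluses of the two cross pairs — with the exact `Φ` for principal cross pairs. It holds
on the NEG-B17 witness and survives adversarial climbs on 6 and 7 elements (MINE-B.md §15 Addendum 8);
nothing here depends on the census.
-/

open Finset

namespace Summit.Ventures.PercRepro2

namespace StepZero

open ReimerCube

variable {E : Type*} [DecidableEq E]

open Classical

/-- `A` is principal: `A = {γ : K ⊆ γ}` for some `K` (includes `⊤`, `K = ∅`) -/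
def IsPrincipal (A : Finset E → Prop) : Prop := ∃ K : Finset E, ∀ X, A X ↔ K ⊆ X

/-- the surplus `D_i + E_i − N_i` of the coordinate `i` for `(A, B)` on `insert i U'` -/
noncomputable def surplus (U' : Finset E) (A B : Finset E → Prop) (i : E) : ℤ :=
  (cD U' A B i : ℤ) + cE U' A B i - cN U' A B i

/-- the slack function `f`: the exact `Φ` for principal `A`, else the best clipped surplus -/
noncomputable def fval (U : Finset E) (A B : Finset E → Prop) : ℤ :=
  if IsPrincipal A then Phi U A B
  else ((U.sup (fun i => (surplus (U.erase i) A B i).toNat) : ℕ) : ℤ)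

/-- `Phi_insert` in terms of `surplus` -/
lemma Phi_insert_surplus (U' : Finset E) {i : E} (hi : i ∉ U') {A B : Finset E → Prop} (hA : Incr A)
    (hB : Incr B) :
    Phi (insert i U') A B = Phi U' A (sec1 i B) + Phi U' (sec1 i A) B + surplus U' A B i := by
  rw [Phi_insert U' hi hA hB]; unfold surplus; ring

/-- for a principal `A` the slack is `Φ` itself -/
lemma fval_of_principal (U : Finset E) {A : Finset E → Prop} (B : Finset E → Prop)
    (h : IsPrincipal A) : fval U A B = Phi U A B := by
  unfold fval; rw [if_pos h]

/-- for a non-principal `A` the slack is a non-negative integer -/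
lemma fval_nonneg_of_not_principal (U : Finset E) {A : Finset E → Prop} (B : Finset E → Prop)
    (h : ¬ IsPrincipal A) : 0 ≤ fval U A B := by
  unfold fval; rw [if_neg h]; exact Int.natCast_nonneg _

/-- on the empty cube the slack of a non-principal `A` is `0` -/
lemma fval_empty_of_not_principal {A : Finset E → Prop} (B : Finset E → Prop)
    (h : ¬ IsPrincipal A) : fval ∅ A B = 0 := by
  unfold fval; rw [if_neg h]; simp

/-- **The slack-carrying induction.** Under (GC-f), `f ≤ Φ` for every pair of increasing events on
every finite cube. -/
theorem Phi_ge_fval_of_GCf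
    (hGC : ∀ (U : Finset E) (A B : Finset E → Prop), Incr A → Incr B → U.Nonempty →
      ¬ IsPrincipal A → ∃ i ∈ U, fval U A B ≤ surplus (U.erase i) A B i
        + fval (U.erase i) A (sec1 i B) + fval (U.erase i) (sec1 i A) B) :
    ∀ (U : Finset E) (A B : Finset E → Prop), Incr A → Incr B → fval U A B ≤ Phi U A B := by
  intro U
  induction U using Finset.strongInduction with
  | H U ih =>
    intro A B hA hB
    by_cases hP : IsPrincipal A
    · rw [fval_of_principal U B hP]
    rcases U.eq_empty_or_nonempty with hU | hU
    · subst hU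
      rw [fval_empty_of_not_principal B hP]
      exact (AS3_iff_Phi_nonneg _ _ _).mp (AS3_empty A B)
    obtain ⟨i, hi, hgc⟩ := hGC U A B hA hB hU hP
    have hi' : i ∉ U.erase i := Finset.notMem_erase i U
    have hU' : insert i (U.erase i) = U := Finset.insert_erase hi
    have hsub : U.erase i ⊂ U := Finset.erase_ssubset hi
    have h1 := ih _ hsub A (sec1 i B) hA (incr_sec1 hB i)
    have h2 := ih _ hsub (sec1 i A) B (incr_sec1 hA i) hB
    have hid := Phi_insert_surplus (U.erase i) hi' hA hB
    rw [hU'] at hid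
    rw [hid]
    linarith

/-- a principal event with a generator not inside the cube has no (AS3) source -/
lemma AS3_of_principal_not_subset (U : Finset E) {A : Finset E → Prop} (B : Finset E → Prop)
    {K : Finset E} (hK : ∀ X, A X ↔ K ⊆ X) (hKU : ¬ K ⊆ U) : AS3 U A B := by
  unfold AS3
  have h0 : (U.powerset.filter (fun γ => DOcc A B γ ∧ ¬ B (U \ γ))).card = 0 := by
    rw [Finset.card_eq_zero, Finset.filter_eq_empty_iff]
    intro γ hγ h
    obtain ⟨K', L, hK', -, -, hAK', -⟩ := h.1
    exact hKU (((hK K').mp (hAK' K' le_rfl)).trans (hK'.trans (Finset.mem_powerset.mp hγ)))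
  rw [h0]
  exact Nat.zero_le _

/-- **(AS3) from the slack-carrying induction**: (GC-f) implies (AS3) for every pair of increasing
events on every finite cube. -/
theorem AS3_of_GCf
    (hGC : ∀ (U : Finset E) (A B : Finset E → Prop), Incr A → Incr B → U.Nonempty →
      ¬ IsPrincipal A → ∃ i ∈ U, fval U A B ≤ surplus (U.erase i) A B i
        + fval (U.erase i) A (sec1 i B) + fval (U.erase i) (sec1 i A) B) :
    ∀ (U : Finset E) (A B : Finset E → Prop), Incr A → Incr B → AS3 U A B := by
  intro U A B hA hB
  by_cases hP : IsPrincipal A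
  · obtain ⟨K, hK⟩ := hP
    by_cases hKU : K ⊆ U
    · have hAeq : A = fun γ => K ⊆ γ := funext (fun X => propext (hK X))
      rw [hAeq]
      exact AS3_of_principal U K hKU B hB
    · exact AS3_of_principal_not_subset U B hK hKU
  · rw [AS3_iff_Phi_nonneg]
    exact le_trans (fval_nonneg_of_not_principal U B hP) (Phi_ge_fval_of_GCf hGC U A B hA hB)

/-! ## The cube-relative version (principality on the cube, as in the census) -/

/-- `A` is principal on the cube `U`: `A = {γ : K ⊆ γ}` on the subsets of `U`, for some `K ⊆ U`
(includes `⊤`, `K = ∅`, and the events with no member inside `U` when `U` is nonempty is excluded: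
those have no source anyway) -/
def IsPrincipalOn (U : Finset E) (A : Finset E → Prop) : Prop :=
  ∃ K ⊆ U, ∀ X ⊆ U, (A X ↔ K ⊆ X)


/-- the slack function `f` with principality ON THE CUBE (the notion of the census gcf2.c / gcf5.c):
the exact `Φ` for `A` principal on `U`, else the best clipped surplus -/
noncomputable def fvalOn (U : Finset E) (A B : Finset E → Prop) : ℤ :=
  if IsPrincipalOn U A then Phi U A B
  else ((U.sup (fun i => (surplus (U.erase i) A B i).toNat) : ℕ) : ℤ)

/-- for a principal `A` the slack is `Φ` itself -/
lemma fvalOn_of_principal (U : Finset E) {A : Finset E → Prop} (B : Finset E → Prop)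
    (h : IsPrincipalOn U A) : fvalOn U A B = Phi U A B := by
  unfold fvalOn; rw [if_pos h]

/-- for a non-principal `A` the slack is a non-negative integer -/
lemma fvalOn_nonneg_of_not_principal (U : Finset E) {A : Finset E → Prop} (B : Finset E → Prop)
    (h : ¬ IsPrincipalOn U A) : 0 ≤ fvalOn U A B := by
  unfold fvalOn; rw [if_neg h]; exact Int.natCast_nonneg _

/-- on the empty cube the slack of a non-principal `A` is `0` -/
lemma fvalOn_empty_of_not_principal {A : Finset E → Prop} (B : Finset E → Prop)
    (h : ¬ IsPrincipalOn ∅ A) : fvalOn ∅ A B = 0 := by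
  unfold fvalOn; rw [if_neg h]; simp

/-- **The slack-carrying induction, cube-relative version.** Under (GC-f) with principality on the
cube, `fvalOn ≤ Φ` for every pair of increasing events on every finite cube. -/
theorem Phi_ge_fvalOn_of_GCfOn
    (hGC : ∀ (U : Finset E) (A B : Finset E → Prop), Incr A → Incr B → U.Nonempty →
      ¬ IsPrincipalOn U A → ∃ i ∈ U, fvalOn U A B ≤ surplus (U.erase i) A B i
        + fvalOn (U.erase i) A (sec1 i B) + fvalOn (U.erase i) (sec1 i A) B) :
    ∀ (U : Finset E) (A B : Finset E → Prop), Incr A → Incr B → fvalOn U A B ≤ Phi U A B := by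
  intro U
  induction U using Finset.strongInduction with
  | H U ih =>
    intro A B hA hB
    by_cases hP : IsPrincipalOn U A
    · rw [fvalOn_of_principal U B hP]
    rcases U.eq_empty_or_nonempty with hU | hU
    · subst hU
      rw [fvalOn_empty_of_not_principal B hP]
      exact (AS3_iff_Phi_nonneg _ _ _).mp (AS3_empty A B)
    obtain ⟨i, hi, hgc⟩ := hGC U A B hA hB hU hP
    have hi' : i ∉ U.erase i := Finset.notMem_erase i U
    have hU' : insert i (U.erase i) = U := Finset.insert_erase hi
    have hsub : U.erase i ⊂ U := Finset.erase_ssubset hi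
    have h1 := ih _ hsub A (sec1 i B) hA (incr_sec1 hB i)
    have h2 := ih _ hsub (sec1 i A) B (incr_sec1 hA i) hB
    have hid := Phi_insert_surplus (U.erase i) hi' hA hB
    rw [hU'] at hid
    rw [hid]
    linarith

omit [DecidableEq E] in
/-- disjoint occurrence only sees the values of the increasing first event on subsets of the cube -/
lemma dOcc_congr_left {A A' B : Finset E → Prop} (hA : Incr A) (hA' : Incr A') (U : Finset E)
    (h : ∀ X ⊆ U, (A X ↔ A' X)) {γ : Finset E} (hγ : γ ⊆ U) : DOcc A B γ ↔ DOcc A' B γ := by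
  constructor
  · rintro ⟨K, L, hK, hL, hd, hAK, hBL⟩
    exact ⟨K, L, hK, hL, hd, fun T hT => hA' hT ((h K (hK.trans hγ)).mp (hAK K le_rfl)), hBL⟩
  · rintro ⟨K, L, hK, hL, hd, hAK, hBL⟩
    exact ⟨K, L, hK, hL, hd, fun T hT => hA hT ((h K (hK.trans hγ)).mpr (hAK K le_rfl)), hBL⟩

/-- (AS3) only sees the values of the increasing first event on subsets of the cube -/
lemma AS3_congr_left {A A' B : Finset E → Prop} (hA : Incr A) (hA' : Incr A') (U : Finset E)
    (h : ∀ X ⊆ U, (A X ↔ A' X)) : AS3 U A B ↔ AS3 U A' B := by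
  unfold AS3
  have e1 : U.powerset.filter (fun γ => DOcc A B γ ∧ ¬ B (U \ γ))
      = U.powerset.filter (fun γ => DOcc A' B γ ∧ ¬ B (U \ γ)) := by
    apply Finset.filter_congr
    intro γ hγ
    rw [dOcc_congr_left hA hA' U h (Finset.mem_powerset.mp hγ)]
  have e2 : U.powerset.filter (fun γ => A γ ∧ B (U \ γ) ∧ ¬ DOcc B B (U \ γ))
      = U.powerset.filter (fun γ => A' γ ∧ B (U \ γ) ∧ ¬ DOcc B B (U \ γ)) := by
    apply Finset.filter_congr
    intro γ hγ
    rw [h γ (Finset.mem_powerset.mp hγ)]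
  rw [e1, e2]

/-- (AS3) for an event that is principal on the cube -/
lemma AS3_of_principalOn (U : Finset E) {A B : Finset E → Prop} (hA : Incr A) (hB : Incr B)
    (hP : IsPrincipalOn U A) : AS3 U A B := by
  obtain ⟨K, hKU, hK⟩ := hP
  rw [AS3_congr_left hA (A' := fun γ => K ⊆ γ) (fun _ _ hST h => h.trans hST) U hK]
  exact AS3_of_principal U K hKU B hB

/-- **(AS3) from the cube-relative slack-carrying induction.** -/
theorem AS3_of_GCfOn
    (hGC : ∀ (U : Finset E) (A B : Finset E → Prop), Incr A → Incr B → U.Nonempty →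
      ¬ IsPrincipalOn U A → ∃ i ∈ U, fvalOn U A B ≤ surplus (U.erase i) A B i
        + fvalOn (U.erase i) A (sec1 i B) + fvalOn (U.erase i) (sec1 i A) B) :
    ∀ (U : Finset E) (A B : Finset E → Prop), Incr A → Incr B → AS3 U A B := by
  intro U A B hA hB
  by_cases hP : IsPrincipalOn U A
  · exact AS3_of_principalOn U hA hB hP
  · rw [AS3_iff_Phi_nonneg]
    exact le_trans (fvalOn_nonneg_of_not_principal U B hP) (Phi_ge_fvalOn_of_GCfOn hGC U A B hA hB)

end StepZero

end Summit.Ventures.PercRepro2
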